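/-
Copyright (c) 2026 the pub-hodgecm-mathlib formalisation cell (harness21).  Prover seat hodgecm-mathlib-K2Liu-p05 (g6), Track B «K2-LIT»,
#184♮ = hLiu418 = `stmt-HodgeConjecture-24832`; #42S organ S2, S2-asm road (γ): the generic curve algebra of the (der) CUT file D1
(`K2/K2Liu-p05/g6/CUT-der-instance.K2Liu-p05-g6.md` 7ac655e69c8f80a2 (C1)(C2); LEAD F0P6-plan (g14) BATCH #41).
-/
import Summits.HodgeConjecture.HodgeConjecture.Theorems.K2LiuU22ShilovCoordinate     -- ★ `cayley_diag_one_eq`, `kU_mem_UJ` (+ ★ PMinus: `cayley_mul_cayleyInv`, `cayleyInv_mul_cayley`)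
import Mathlib.Analysis.Normed.Algebra.MatrixExponential                              -- `Matrix.exp_units_conj`
import HarnessLib

/-!
# Crux `HLiu418`, S2-asm road (γ), (der) D1 generic half: THE TUBE CURVE `k_u · exp(tX)` IN PRODUCT COORDINATES —
# `y[w ↦ a·b] = y[w ↦ a] · δ_w(b)` under any multiplicative map, and `k_u · exp(t·C M C′) = C · (diag(1,u) · exp(t·M)) · C′`

Cell `hodgecm-mathlib`, crux item hLiu418 = `stmt-HodgeConjecture-24832`; squad K2 ∕ K2Liu; LEAD F0P6-plan (g14), co-dealer K2E5-plan (g7); prover K2Liu-p05 (g6).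
THEOREMS ONLY (no `def`, no `instance`, no notation, no named-fact hypothesis, no `sorry`); lane `--supports stmt-HodgeConjecture-24832 --as helper`.

WHY.  ★ p861135 `archSWRegionSpanning_of_readings`' (derv) clause differentiates `t ↦ val Φ (archPiEquivCM⁻¹ (y[w ↦ ιw w (k_u · exp (tX))]))` with `X = C M C′ ∈ 𝔲(J)`
(`C, C′` the Cayley pair, `M ∈ 𝔲(2,2)` diagonal form); ★ (r-b)-uniform p860738 differentiates `s ↦ f(H · archEmb (ψ (expMem (s•Y′))))`.  The two curves agree once
(C1) the frozen tuple is peeled off — `φ (y[w ↦ a·b]) = φ (y[w ↦ a]) · φ (δ_w b)` for any multiplicative `φ` (here `archToAdelic ∘ archPiEquivCM⁻¹`) — and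
(C2) the tube curve is moved to the diagonal form — `k_u · exp (t • C M C′) = C · (diag(1,u) · exp (t • M)) · C′` (★ `cayley_diag_one_eq`, `Matrix.exp_units_conj` at the
Cayley unit).  This file proves (C1), (C2) and their composite (C3) under the frame letter «`ιw w` multiplicative on `U(J)`» (F1 of the cut memo).
References: [Knapp1986] Ch. VI §2 (Cayley transform); [Hall2015] *Lie Groups, Lie Algebras, and Representations*, Prop. 2.3 (`exp (U X U⁻¹) = U exp(X) U⁻¹`);
[KudlaRallis1994] §1.
HONEST LABEL.  Count-neutral helper: `HC_CM` is proved only modulo the 7 printed citations (2 remaining named inputs: hLiu418 = `stmt-HodgeConjecture-24832`,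
h413 = `stmt-HodgeConjecture-24833`) until rung 0 closes; this file closes no socket.
-/

set_option autoImplicit false
set_option linter.dupNamespace false -- the mandated namespace repeats `HodgeConjecture.HodgeConjecture`

noncomputable section

open Complex Matrix
open Summit.HodgeConjecture.HodgeConjecture.Cruxes.HLiu418.K2LiuHermitianTubeFramePMinus
open Summit.HodgeConjecture.HodgeConjecture.Cruxes.HLiu418.K2LiuU22ShilovCoordinate

namespace Summit.HodgeConjecture.HodgeConjecture.Cruxes.HLiu418.K2LiuArchTubeCurveAlgebra

/-! ## §1 (C1) Peeling the frozen tuple -/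

section Pi

variable {ι : Type*} [DecidableEq ι] {G : ι → Type*} [∀ i, MulOneClass (G i)]

/-- `y[i ↦ a·b] = y[i ↦ a] · δ_i(b)` in the product monoid. [folklore] -/
theorem update_mul_eq_update_mul_mulSingle (y : ∀ i, G i) (i : ι) (a b : G i) :
    Function.update y i (a * b) = Function.update y i a * Pi.mulSingle i b := by
  funext j
  by_cases hj : j = i
  · subst hj
    rw [Pi.mul_apply, Function.update_self, Function.update_self, Pi.mulSingle_eq_same]
  · rw [Pi.mul_apply, Function.update_of_ne hj, Function.update_of_ne hj, Pi.mulSingle_eq_of_ne hj, mul_one]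

/-- **(C1)**: under any multiplicative map `φ` out of the product (here `archToAdelic ∘ archPiEquivCM⁻¹`), `φ (y[i ↦ a·b]) = φ (y[i ↦ a]) · φ (δ_i b)`. [folklore] -/
theorem map_update_mul {A : Type*} [Mul A] {F : Type*} [FunLike F (∀ i, G i) A] [MulHomClass F (∀ i, G i) A] (φ : F) (y : ∀ i, G i) (i : ι) (a b : G i) :
    φ (Function.update y i (a * b)) = φ (Function.update y i a) * φ (Pi.mulSingle i b) := by
  rw [update_mul_eq_update_mul_mulSingle, map_mul]

/-- iterated: `φ (y[i ↦ a·b·c]) = φ (y[i ↦ a]) · φ (δ_i b) · φ (δ_i c)`. [folklore] -/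
theorem map_update_mul_mul {A : Type*} [Monoid A] {F : Type*} [FunLike F (∀ i, G i) A] [MulHomClass F (∀ i, G i) A] (φ : F) (y : ∀ i, G i) (i : ι)
    (a b c : G i) :
    φ (Function.update y i (a * b * c)) = φ (Function.update y i a) * φ (Pi.mulSingle i b) * φ (Pi.mulSingle i c) := by
  rw [map_update_mul, map_update_mul]

end Pi

/-! ## §2 (C2) The tube curve in the diagonal form -/

section Cayley

variable {l : Type*} [Fintype l] [DecidableEq l]

/-- scalars pass through the Cayley conjugation: `t • (C M C′) = C (t • M) C′`. [folklore] -/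
theorem smul_cayley_conj (t : ℝ) (M : Matrix (l ⊕ l) (l ⊕ l) ℂ) :
    t • (fromBlocks 1 1 (I • 1) (-(I • 1)) * M * ((2 : ℂ)⁻¹ • fromBlocks 1 (-(I • 1)) 1 (I • 1)) : Matrix (l ⊕ l) (l ⊕ l) ℂ) =
      fromBlocks 1 1 (I • 1) (-(I • 1)) * (t • M) * ((2 : ℂ)⁻¹ • fromBlocks 1 (-(I • 1)) 1 (I • 1)) := by
  rw [Matrix.mul_smul (fromBlocks 1 1 (I • 1) (-(I • 1)) * M) (2 : ℂ)⁻¹, Matrix.mul_smul (fromBlocks 1 1 (I • 1) (-(I • 1)) * (t • M)) (2 : ℂ)⁻¹,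
    Matrix.mul_smul (fromBlocks 1 1 (I • 1) (-(I • 1))) t M, Matrix.smul_mul t, smul_comm t (2 : ℂ)⁻¹]

/-- **`exp (C M C′) = C · exp M · C′`** (the Cayley pair is a unit: ★ `cayley_mul_cayleyInv`, ★ `cayleyInv_mul_cayley`; `Matrix.exp_units_conj`). [cite: Hall2015, Prop. 2.3] -/
theorem exp_cayley_conj (M : Matrix (l ⊕ l) (l ⊕ l) ℂ) :
    NormedSpace.exp (fromBlocks 1 1 (I • 1) (-(I • 1)) * M * ((2 : ℂ)⁻¹ • fromBlocks 1 (-(I • 1)) 1 (I • 1)) : Matrix (l ⊕ l) (l ⊕ l) ℂ) =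
      fromBlocks 1 1 (I • 1) (-(I • 1)) * NormedSpace.exp M * ((2 : ℂ)⁻¹ • fromBlocks 1 (-(I • 1)) 1 (I • 1)) := by
  let U : (Matrix (l ⊕ l) (l ⊕ l) ℂ)ˣ :=
    ⟨fromBlocks 1 1 (I • 1) (-(I • 1)), (2 : ℂ)⁻¹ • fromBlocks 1 (-(I • 1)) 1 (I • 1), cayley_mul_cayleyInv, cayleyInv_mul_cayley⟩
  have hU : ((U : (Matrix (l ⊕ l) (l ⊕ l) ℂ)ˣ) : Matrix (l ⊕ l) (l ⊕ l) ℂ) = fromBlocks 1 1 (I • 1) (-(I • 1)) := rfl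
  have hU' : ((U⁻¹ : (Matrix (l ⊕ l) (l ⊕ l) ℂ)ˣ) : Matrix (l ⊕ l) (l ⊕ l) ℂ) = (2 : ℂ)⁻¹ • fromBlocks 1 (-(I • 1)) 1 (I • 1) := rfl
  rw [← hU, ← hU']
  exact Matrix.exp_units_conj U M

/-- `exp (t • C M C′) = C · exp (t • M) · C′`. [cite: Hall2015, Prop. 2.3] -/
theorem exp_smul_cayley_conj (t : ℝ) (M : Matrix (l ⊕ l) (l ⊕ l) ℂ) :
    NormedSpace.exp (t • (fromBlocks 1 1 (I • 1) (-(I • 1)) * M * ((2 : ℂ)⁻¹ • fromBlocks 1 (-(I • 1)) 1 (I • 1)) : Matrix (l ⊕ l) (l ⊕ l) ℂ)) =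
      fromBlocks 1 1 (I • 1) (-(I • 1)) * NormedSpace.exp (t • M) * ((2 : ℂ)⁻¹ • fromBlocks 1 (-(I • 1)) 1 (I • 1)) := by
  rw [smul_cayley_conj, exp_cayley_conj]

/-- **(C2): `k_u · exp (t • C M C′) = C · (diag(1,u) · exp (t • M)) · C′`** — the tube compact-picture curve is the Cayley conjugate of the diagonal-form curve
`diag(1,u) · exp (t • M)` (★ `cayley_diag_one_eq`: `k_u = C diag(1,u) C′`). [cite: Knapp1986, Ch. VI §2] [cite: Hall2015, Prop. 2.3] -/
theorem kU_mul_exp_smul_cayley (u : Matrix l l ℂ) (t : ℝ) (M : Matrix (l ⊕ l) (l ⊕ l) ℂ) :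
    ((2 : ℂ)⁻¹ • (fromBlocks (1 + u) (-(I • (1 - u))) (I • (1 - u)) (1 + u) : Matrix (l ⊕ l) (l ⊕ l) ℂ)) *
        NormedSpace.exp (t • (fromBlocks 1 1 (I • 1) (-(I • 1)) * M * ((2 : ℂ)⁻¹ • fromBlocks 1 (-(I • 1)) 1 (I • 1)) : Matrix (l ⊕ l) (l ⊕ l) ℂ)) =
      fromBlocks 1 1 (I • 1) (-(I • 1)) * (fromBlocks 1 0 0 u * NormedSpace.exp (t • M)) * ((2 : ℂ)⁻¹ • fromBlocks 1 (-(I • 1)) 1 (I • 1)) := by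
  rw [exp_smul_cayley_conj, ← cayley_diag_one_eq u]
  simp only [Matrix.mul_assoc]
  rw [← Matrix.mul_assoc ((2 : ℂ)⁻¹ • fromBlocks 1 (-(I • 1)) 1 (I • 1)) (fromBlocks 1 1 (I • 1) (-(I • 1))), cayleyInv_mul_cayley, Matrix.one_mul]

end Cayley

/-! ## §3 (C3) The curve in product coordinates, under the frame letter (F1) -/

section Curve

variable {ι : Type*} [DecidableEq ι] {G : ι → Type*} [∀ i, MulOneClass (G i)] {A : Type*} [Monoid A] {F : Type*} [FunLike F (∀ i, G i) A]
  [MulHomClass F (∀ i, G i) A] {l : Type*} [Fintype l] [DecidableEq l]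

/-- **(C3) THE TUBE CURVE PEELED**: for a chart `ιw : M(ℂ) → G w` multiplicative on `U(J)` (frame letter (F1)), `u` unitary and `E ∈ U(J)` (e.g. `E = exp (tX)`, `X ∈ 𝔲(J)`),
`φ (y[w ↦ ιw (k_u · E)]) = φ (y[w ↦ ιw k_u]) · φ (δ_w (ιw E))` — the base point `H_{y,u}` times a one-place factor, the shape ★ p860738 differentiates (`H · archEmb (ψ …)`).
[cite: KudlaRallis1994, §1] [cite: Knapp1986, Ch. VI §2] -/
theorem map_update_chart_kU_mul (φ : F) (y : ∀ i, G i) (w : ι) (ιw : Matrix (l ⊕ l) (l ⊕ l) ℂ → G w)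
    (hι : ∀ g h : Matrix (l ⊕ l) (l ⊕ l) ℂ, gᴴ * Matrix.J l ℂ * g = Matrix.J l ℂ → hᴴ * Matrix.J l ℂ * h = Matrix.J l ℂ → ιw (g * h) = ιw g * ιw h)
    {u : Matrix l l ℂ} (hu : uᴴ * u = 1) {E : Matrix (l ⊕ l) (l ⊕ l) ℂ} (hE : Eᴴ * Matrix.J l ℂ * E = Matrix.J l ℂ) :
    φ (Function.update y w (ιw (((2 : ℂ)⁻¹ • (fromBlocks (1 + u) (-(I • (1 - u))) (I • (1 - u)) (1 + u) : Matrix (l ⊕ l) (l ⊕ l) ℂ)) * E))) =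
      φ (Function.update y w (ιw ((2 : ℂ)⁻¹ • (fromBlocks (1 + u) (-(I • (1 - u))) (I • (1 - u)) (1 + u) : Matrix (l ⊕ l) (l ⊕ l) ℂ)))) *
        φ (Pi.mulSingle w (ιw E)) := by
  rw [hι _ _ (kU_mem_UJ hu) hE, map_update_mul]

end Curve

end Summit.HodgeConjecture.HodgeConjecture.Cruxes.HLiu418.K2LiuArchTubeCurveAlgebra

end
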